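import Mathlib
import Summits.Ventures.HodgeRepro2.T5PrincipalUnitFiltration
import Summits.Ventures.HodgeRepro2.T5PrincipalUnitComparison
import Summits.Ventures.HodgeRepro2.T5ConductorExistence

/-!
# Higher unit groups of a RAMIFIED quadratic extension of discrete valuation rings

Kernel witnesses for the filtration identities behind Lemma N5.L4(iv-a)/(iv-b) of
`route/TIER5.md` (§N5.11.4, route-2's block) — the RAMIFIED counterpart of the inert
statements of `T5PrincipalUnitComparison` / `T5ConductorExistence` / `T5AdicCompletionInert`:

* the prose «`F_v^× ∩ U_E^{2t+1} = U_F^{t+1}`» (iv-a) and «`F_v^× ∩ U_E^{2k} = U_F^{k}`», i.e. for a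
  unit `x` of the base ring, `x ∈ U_E^n ⟺ x ∈ U_F^{⌈n/2⌉}` (`unitsMap_mem_higherUnits_iff`);
* the prose «`U_E^{2k−1} ∩ F_v^× U_E^{2k} = U_E^{2k}`» (iv-b) (`mem_higherUnits_of_mem_sup`,
  `inf_sup_eq`), and its consequence that `U_E^{2k−1} ⊄ F_v^× U_E^{2k}`
  (`exists_mem_higherUnits_not_mem_sup`), so that a character of the finite group
  `U_E / U_E^{2k} U_{F_v}` non-trivial on the image of `U_E^{2k−1}` exists
  (`exists_character_exact_even_level`: «conjugate-orthogonal characters of every EVEN exact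
  conductor `2k ≥ 2` exist at a ramified place»);
* the parenthetical of (iv-b): «no conjugate-orthogonal character of ODD conductor exists at a
  ramified `v`: `U_E^{2k} ⊂ F_v^× U_E^{2k+1}` since `U_E^{2k}/U_E^{2k+1} ≅ k_E` is the image of
  `U_F^k`» — here from the residue-degree-one hypothesis «every element of `S` is congruent
  modulo `ϖ` to an element of `R`» (`higherUnits_two_mul_le_sup`,
  `eq_one_of_mem_higherUnits_two_mul`), including the conductor-one case `k = 0`.

Setting: `R → S` an algebra of discrete valuation rings with uniformisers `π`, `ϖ` such that
`algebraMap R S π = u * ϖ ^ 2` for a unit `u` of `S` (the RAMIFIED QUADRATIC shape `e = 2`;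
injectivity of `R → S` is a consequence, `algebraMap_ne_zero`). The residue-degree-one
input `f = 1` enters only through the elementwise hypothesis `hres`. The objects are the ones
of the earlier files: `higherUnits ϖ n = {u ∣ ϖ ^ n ∣ u − 1}` and `unitsMap : Rˣ →* Sˣ`.

What is NOT here: the local fields themselves (the instantiation on Mathlib's completions is a
separate file), characters of `E_v^×` (only of the unit group `Sˣ`), and anything about ε-factors.
Declaration per README §8(d): «uses an L-value-free non-vanishing device: NO».
-/

namespace Summit.Ventures.HodgeRepro2.T5RamifiedUnitFiltration

open T5PrincipalUnitFiltration T5PrincipalUnitComparison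

section Ring

variable {R S : Type*} [CommRing R] [CommRing S] [Algebra R S]
variable {π : R} {ϖ : S} {u : Sˣ}

/-- The ramified shape `algebraMap π = u * ϖ ^ 2` raised to the `k`-th power:
`algebraMap (π ^ k) = u ^ k * ϖ ^ (2k)`. -/
theorem algebraMap_pow_eq (hπ : algebraMap R S π = u * ϖ ^ 2) (k : ℕ) :
    algebraMap R S (π ^ k) = ((u ^ k : Sˣ) : S) * ϖ ^ (2 * k) := by
  rw [map_pow, hπ, mul_pow, ← pow_mul, Units.val_pow_eq_pow_val]

/-- `π ^ k ∣ r` in `R` implies `ϖ ^ (2k) ∣ algebraMap r` in `S` (the easy direction of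
«`v_E = 2 v_F` on `F_v`»). -/
theorem pow_dvd_algebraMap_of_dvd (hπ : algebraMap R S π = u * ϖ ^ 2) {k : ℕ} {r : R}
    (h : π ^ k ∣ r) : ϖ ^ (2 * k) ∣ algebraMap R S r := by
  obtain ⟨c, rfl⟩ := h
  rw [map_mul, algebraMap_pow_eq hπ, mul_assoc]
  exact Units.dvd_mul_left.2 (dvd_mul_right _ _)

/-- The image of `U_F^k` lies in `U_E^{2k}` (the prose «`U_{F_v}^k ⊂ U_E^{2k}`» of
Lemma N5.L4(iv-a)/(iv-b)). -/
theorem unitsMap_mem_higherUnits_two_mul (hπ : algebraMap R S π = u * ϖ ^ 2) {k : ℕ} {x : Rˣ}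
    (hx : x ∈ higherUnits π k) : unitsMap x ∈ higherUnits ϖ (2 * k) := by
  rw [mem_higherUnits] at hx ⊢
  have h : ((unitsMap x : Sˣ) : S) - 1 = algebraMap R S ((x : R) - 1) := by
    rw [map_sub, map_one]; rfl
  rw [h]
  exact pow_dvd_algebraMap_of_dvd hπ hx

/-- If `(y : S) - algebraMap x` is divisible by `ϖ ^ n` for a unit `x` of `R`, then
`y ∈ U_E^n · image(Rˣ)` (the element `y · algebraMap x⁻¹` lies in `U_E^n`). -/
theorem mem_sup_of_sub_algebraMap_dvd {n : ℕ} {y : Sˣ} {x : Rˣ}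
    (h : ϖ ^ n ∣ (y : S) - algebraMap R S x) :
    y ∈ higherUnits ϖ n ⊔ (unitsMap (R := R) (S := S)).range := by
  refine Subgroup.mem_sup.2 ⟨y * (unitsMap x)⁻¹, ?_, unitsMap x, ⟨x, rfl⟩, inv_mul_cancel_right _ _⟩
  rw [mem_higherUnits]
  have e : ((y * (unitsMap x)⁻¹ : Sˣ) : S) - 1 =
      ((y : S) - algebraMap R S x) * (((unitsMap x)⁻¹ : Sˣ) : S) := by
    rw [Units.val_mul, sub_mul]
    congr 1
    exact (Units.mul_inv (unitsMap x)).symm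
  rw [e]
  exact h.mul_right _

end Ring

section DVR

variable {R S : Type*} [CommRing R] [CommRing S] [Algebra R S]
variable [IsDomain R] [IsDomain S] [IsDiscreteValuationRing R]
variable {π : R} {ϖ : S} {u : Sˣ}

/-- In the ramified shape the algebra map is injective on non-zero elements (so the hypothesis
«`R → S` injective» of the inert files is automatic here). -/
theorem algebraMap_ne_zero (hπ' : Irreducible π) (hϖ : Irreducible ϖ)
    (hπ : algebraMap R S π = u * ϖ ^ 2) {r : R} (hr : r ≠ 0) : algebraMap R S r ≠ 0 := by
  obtain ⟨k, w, rfl⟩ := IsDiscreteValuationRing.eq_unit_mul_pow_irreducible hr hπ'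
  rw [map_mul, algebraMap_pow_eq hπ, ← mul_assoc]
  exact mul_ne_zero ((w.isUnit.map (algebraMap R S)).mul (u ^ k).isUnit).ne_zero
    (pow_ne_zero _ hϖ.ne_zero)

/-- THE DICTIONARY «`v_E(algebraMap r) = 2 v_F(r)`» in divisibility form:
`ϖ ^ n ∣ algebraMap r ⟺ π ^ ⌈n/2⌉ ∣ r` (with `⌈n/2⌉ = (n + 1) / 2`). -/
theorem pow_dvd_algebraMap_iff (hπ' : Irreducible π) (hϖ : Irreducible ϖ)
    (hπ : algebraMap R S π = u * ϖ ^ 2) (n : ℕ) (r : R) :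
    ϖ ^ n ∣ algebraMap R S r ↔ π ^ ((n + 1) / 2) ∣ r := by
  rcases eq_or_ne r 0 with rfl | hr
  · simp
  obtain ⟨k, w, rfl⟩ := IsDiscreteValuationRing.eq_unit_mul_pow_irreducible hr hπ'
  rw [map_mul, algebraMap_pow_eq hπ, ← mul_assoc,
    ((w.isUnit.map (algebraMap R S)).mul (u ^ k).isUnit).dvd_mul_left, Units.dvd_mul_left,
    pow_dvd_pow_iff hϖ.ne_zero hϖ.not_isUnit, pow_dvd_pow_iff hπ'.ne_zero hπ'.not_isUnit]
  omega

/-- A unit `x` of `R` lies in `U_E^n` iff it lies in `U_F^{⌈n/2⌉}`: the prose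
«`F_v^× ∩ U_E^n = U_F^{⌈n/2⌉}`» of Lemma N5.L4(iv). -/
theorem unitsMap_mem_higherUnits_iff (hπ' : Irreducible π) (hϖ : Irreducible ϖ)
    (hπ : algebraMap R S π = u * ϖ ^ 2) (n : ℕ) (x : Rˣ) :
    unitsMap x ∈ higherUnits ϖ n ↔ x ∈ higherUnits π ((n + 1) / 2) := by
  rw [mem_higherUnits, mem_higherUnits]
  have h : ((unitsMap x : Sˣ) : S) - 1 = algebraMap R S ((x : R) - 1) := by
    rw [map_sub, map_one]; rfl
  rw [h, pow_dvd_algebraMap_iff hπ' hϖ hπ]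

/-- Lemma N5.L4(iv-a): «`F_v^× ∩ U_E^{2t+1} = U_F^{t+1}`». -/
theorem unitsMap_mem_higherUnits_odd_iff (hπ' : Irreducible π) (hϖ : Irreducible ϖ)
    (hπ : algebraMap R S π = u * ϖ ^ 2) (t : ℕ) (x : Rˣ) :
    unitsMap x ∈ higherUnits ϖ (2 * t + 1) ↔ x ∈ higherUnits π (t + 1) := by
  rw [unitsMap_mem_higherUnits_iff hπ' hϖ hπ]
  have h : (2 * t + 1 + 1) / 2 = t + 1 := by omega
  rw [h]

/-- Lemma N5.L4(iv-b): «`F_v^× ∩ U_E^{2k} = U_F^{k}`». -/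
theorem unitsMap_mem_higherUnits_even_iff (hπ' : Irreducible π) (hϖ : Irreducible ϖ)
    (hπ : algebraMap R S π = u * ϖ ^ 2) (k : ℕ) (x : Rˣ) :
    unitsMap x ∈ higherUnits ϖ (2 * k) ↔ x ∈ higherUnits π k := by
  rw [unitsMap_mem_higherUnits_iff hπ' hϖ hπ]
  have h : (2 * k + 1) / 2 = k := by omega
  rw [h]

/-- Lemma N5.L4(iv-b), the identity «`U_E^{2k−1} ∩ F_v^× U_E^{2k} = U_E^{2k}`» (indices shifted
by one: `U_E^{2k+1} ∩ (U_E^{2k+2} · image(Rˣ)) ⊆ U_E^{2k+2}`): if `y = x · z` with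
`z ∈ U_E^{2k+2}` and `x` from `Rˣ`, then `x ∈ F_v^× ∩ U_E^{2k+1} = U_F^{k+1} ⊂ U_E^{2k+2}`. -/
theorem mem_higherUnits_of_mem_sup (hπ' : Irreducible π) (hϖ : Irreducible ϖ)
    (hπ : algebraMap R S π = u * ϖ ^ 2) {k : ℕ} {y : Sˣ}
    (hy : y ∈ higherUnits ϖ (2 * k + 1))
    (h : y ∈ higherUnits ϖ (2 * k + 2) ⊔ (unitsMap (R := R) (S := S)).range) :
    y ∈ higherUnits ϖ (2 * k + 2) := by
  obtain ⟨a, ha, b, ⟨r, rfl⟩, rfl⟩ := Subgroup.mem_sup.1 h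
  have hb : unitsMap r ∈ higherUnits ϖ (2 * k + 1) := by
    have e : unitsMap r = a⁻¹ * (a * unitsMap r) := by group
    rw [e]
    exact (higherUnits ϖ (2 * k + 1)).mul_mem
      ((higherUnits ϖ (2 * k + 1)).inv_mem (higherUnits_succ_le ϖ (2 * k + 1) ha)) hy
  rw [unitsMap_mem_higherUnits_odd_iff hπ' hϖ hπ] at hb
  have hb2 := unitsMap_mem_higherUnits_two_mul hπ hb
  have e2 : 2 * (k + 1) = 2 * k + 2 := by ring
  rw [e2] at hb2
  exact (higherUnits ϖ (2 * k + 2)).mul_mem ha hb2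

/-- The subgroup form of the previous identity:
`U_E^{2k+1} ⊓ (U_E^{2k+2} ⊔ image(Rˣ)) = U_E^{2k+2}`. -/
theorem inf_sup_eq (hπ' : Irreducible π) (hϖ : Irreducible ϖ)
    (hπ : algebraMap R S π = u * ϖ ^ 2) (k : ℕ) :
    higherUnits ϖ (2 * k + 1) ⊓ (higherUnits ϖ (2 * k + 2) ⊔ (unitsMap (R := R) (S := S)).range) =
      higherUnits ϖ (2 * k + 2) := by
  refine le_antisymm (fun y hy => ?_) (le_inf (higherUnits_succ_le ϖ _) le_sup_left)
  rw [Subgroup.mem_inf] at hy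
  exact mem_higherUnits_of_mem_sup hπ' hϖ hπ hy.1 hy.2

variable [IsDiscreteValuationRing S]

/-- `1 + ϖ ^ (2k+1)` is a unit of `U_E^{2k+1}` outside `U_E^{2k+2} · image(Rˣ)`: the prose
«`F_v^× U_E^{2k−1} / F_v^× U_E^{2k} ≅ U_E^{2k−1}/U_E^{2k} ≅ k_E ≠ 0`» of Lemma N5.L4(iv-b),
in the form used by the character-existence step. -/
theorem exists_mem_higherUnits_not_mem_sup (hπ' : Irreducible π) (hϖ : Irreducible ϖ)
    (hπ : algebraMap R S π = u * ϖ ^ 2) (k : ℕ) :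
    ∃ y ∈ higherUnits ϖ (2 * k + 1),
      y ∉ higherUnits ϖ (2 * k + 2) ⊔ (unitsMap (R := R) (S := S)).range := by
  have hmem : ϖ ^ (2 * k + 1) ∈ IsLocalRing.maximalIdeal S :=
    Ideal.pow_mem_of_mem _ ((IsLocalRing.mem_maximalIdeal ϖ).2 (mem_nonunits_iff.2 hϖ.not_isUnit))
      _ (by omega)
  have hunit : IsUnit (1 + ϖ ^ (2 * k + 1)) := by
    rcases IsLocalRing.isUnit_or_isUnit_one_sub_self (-(ϖ ^ (2 * k + 1))) with h | h
    · exact absurd ((IsUnit.neg_iff _).1 h)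
        (mem_nonunits_iff.1 ((IsLocalRing.mem_maximalIdeal _).1 hmem))
    · simpa [sub_neg_eq_add] using h
  obtain ⟨y, hy⟩ := hunit
  have hy1 : y ∈ higherUnits ϖ (2 * k + 1) := by
    rw [mem_higherUnits, hy, add_sub_cancel_left]
  refine ⟨y, hy1, fun h => ?_⟩
  have h2 := mem_higherUnits_of_mem_sup hπ' hϖ hπ hy1 h
  rw [mem_higherUnits, hy, add_sub_cancel_left, pow_dvd_pow_iff hϖ.ne_zero hϖ.not_isUnit] at h2
  omega

/-- Lemma N5.L4(iv-b), the character-existence step, with `S` of finite residue field: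
for every `k` there is a character of `Sˣ` trivial on `U_E^{2k+2}` and on the image of `Rˣ`
and non-trivial on `U_E^{2k+1}` — «a conjugate-orthogonal character of exact conductor `2k+2`
exists at a ramified place» at the level of the unit group. -/
theorem exists_character_exact_even_level (hπ' : Irreducible π) (hϖ : Irreducible ϖ)
    (hπ : algebraMap R S π = u * ϖ ^ 2) [Finite (IsLocalRing.ResidueField S)] (k : ℕ) :
    ∃ χ : Sˣ →* ℂˣ, (∀ y ∈ higherUnits ϖ (2 * k + 2), χ y = 1) ∧
      (∀ r : Rˣ, χ (unitsMap r) = 1) ∧ ∃ y ∈ higherUnits ϖ (2 * k + 1), χ y ≠ 1 := by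
  obtain ⟨y, hy, hy'⟩ := exists_mem_higherUnits_not_mem_sup hπ' hϖ hπ k
  haveI : (higherUnits ϖ (2 * k + 2)).FiniteIndex :=
    T5ConductorExistence.finiteIndex_higherUnits ϖ hϖ _
  haveI : (higherUnits ϖ (2 * k + 2) ⊔ (unitsMap (R := R) (S := S)).range).FiniteIndex :=
    Subgroup.finiteIndex_of_le le_sup_left
  obtain ⟨χ, hχ, hχy⟩ := T5ConductorExistence.exists_monoidHom_trivial_on_ne_one _ hy'
  exact ⟨χ, fun z hz => hχ z (Subgroup.mem_sup_left hz),
    fun r => hχ _ (Subgroup.mem_sup_right ⟨r, rfl⟩), y, hy, hχy⟩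

end DVR

/-! ### Residue degree one: the even-level groups are generated by the next level and the base

The hypothesis `hres` says that every element of `S` is congruent modulo `ϖ` to an element of
`R` («`k_E = k_F`», residue degree `f = 1`, as at every ramified place of a quadratic
extension). Only `R` needs to be a discrete valuation ring here. -/

section ResidueDegreeOne

variable {R S : Type*} [CommRing R] [CommRing S] [Algebra R S]
variable [IsDomain R] [IsDiscreteValuationRing R]
variable {π : R} {ϖ : S} {u : Sˣ}

/-- `f = 1`, level `0`: every unit of `S` is congruent modulo `ϖ` to a unit of `R`
(«`U_E = U_E^1 · U_F`»). -/
theorem exists_unit_sub_algebraMap_dvd_one (hπ' : Irreducible π) (hϖ : Irreducible ϖ)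
    (hπ : algebraMap R S π = u * ϖ ^ 2)
    (hres : ∀ s : S, ∃ a : R, ϖ ∣ s - algebraMap R S a) (y : Sˣ) :
    ∃ x : Rˣ, ϖ ∣ (y : S) - algebraMap R S x := by
  obtain ⟨a, ha⟩ := hres y
  have ha' : IsUnit a := by
    by_contra hna
    have hmem : a ∈ IsLocalRing.maximalIdeal R :=
      (IsLocalRing.mem_maximalIdeal a).2 (mem_nonunits_iff.2 hna)
    rw [(IsDiscreteValuationRing.irreducible_iff_uniformizer π).1 hπ',
      Ideal.mem_span_singleton] at hmem
    have h1 : ϖ ∣ algebraMap R S a := by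
      obtain ⟨c, rfl⟩ := hmem
      rw [map_mul, hπ]
      exact Dvd.dvd.mul_right (Units.dvd_mul_left.2 (dvd_pow_self ϖ two_ne_zero)) _
    have h2 : ϖ ∣ (y : S) := by
      have h3 := dvd_add ha h1
      rwa [sub_add_cancel] at h3
    exact hϖ.not_isUnit (isUnit_of_dvd_unit h2 y.isUnit)
  obtain ⟨x, rfl⟩ := ha'
  exact ⟨x, ha⟩

/-- `f = 1`, level `2(m+1)`: a unit `y ∈ U_E^{2m+2}` is congruent modulo `ϖ ^ (2m+3)` to the
unit `1 + π ^ (m+1) a` of `R`, where `a` lifts the residue of the cofactor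
(«`U_E^{2k}/U_E^{2k+1} ≅ k_E` is the image of `U_F^k`»). -/
theorem exists_unit_sub_algebraMap_dvd_of_mem_higherUnits (hπ' : Irreducible π)
    (hπ : algebraMap R S π = u * ϖ ^ 2)
    (hres : ∀ s : S, ∃ a : R, ϖ ∣ s - algebraMap R S a) {m : ℕ} {y : Sˣ}
    (hy : y ∈ higherUnits ϖ (2 * m + 2)) :
    ∃ x : Rˣ, ϖ ^ (2 * m + 3) ∣ (y : S) - algebraMap R S x := by
  rw [mem_higherUnits] at hy
  obtain ⟨c, hc⟩ := hy
  obtain ⟨a, ha⟩ := hres ((((u⁻¹ : Sˣ) ^ (m + 1) : Sˣ) : S) * c)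
  have hmemR : π ^ (m + 1) * a ∈ IsLocalRing.maximalIdeal R :=
    Ideal.mul_mem_right _ _ (Ideal.pow_mem_of_mem _
      ((IsLocalRing.mem_maximalIdeal π).2 (mem_nonunits_iff.2 hπ'.not_isUnit)) _ (by omega))
  have hunit : IsUnit (1 + π ^ (m + 1) * a) := by
    rcases IsLocalRing.isUnit_or_isUnit_one_sub_self (-(π ^ (m + 1) * a)) with h | h
    · exact absurd ((IsUnit.neg_iff _).1 h)
        (mem_nonunits_iff.1 ((IsLocalRing.mem_maximalIdeal _).1 hmemR))
    · simpa [sub_neg_eq_add] using h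
  obtain ⟨x, hx⟩ := hunit
  refine ⟨x, ?_⟩
  have key : (y : S) - algebraMap R S x =
      ϖ ^ (2 * (m + 1)) * ((u ^ (m + 1) : Sˣ) : S) *
        (((((u⁻¹ : Sˣ) ^ (m + 1) : Sˣ) : S) * c) - algebraMap R S a) := by
    have hy' : (y : S) = 1 + ϖ ^ (2 * m + 2) * c := by rw [← hc]; ring
    rw [hy', hx, map_add, map_one, map_mul, algebraMap_pow_eq hπ]
    have hu : ((u ^ (m + 1) : Sˣ) : S) * (((u⁻¹ : Sˣ) ^ (m + 1) : Sˣ) : S) = 1 := by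
      rw [← Units.val_mul, ← mul_pow, mul_inv_cancel, one_pow, Units.val_one]
    have e : 2 * m + 2 = 2 * (m + 1) := by ring
    rw [e]
    linear_combination (-(ϖ ^ (2 * (m + 1)) * c)) * hu
  rw [key]
  obtain ⟨d, hd⟩ := ha
  rw [hd]
  have e3 : 2 * m + 3 = 2 * (m + 1) + 1 := by ring
  rw [e3, pow_succ]
  exact ⟨((u ^ (m + 1) : Sˣ) : S) * d, by ring⟩

/-- The parenthetical of Lemma N5.L4(iv-b), «`U_E^{2k} ⊂ F_v^× U_E^{2k+1}`» at residue degree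
one, for every `k` (the case `k = 0` is «`U_E = U_E^1 U_F`»). -/
theorem higherUnits_two_mul_le_sup (hπ' : Irreducible π) (hϖ : Irreducible ϖ)
    (hπ : algebraMap R S π = u * ϖ ^ 2)
    (hres : ∀ s : S, ∃ a : R, ϖ ∣ s - algebraMap R S a) (k : ℕ) :
    higherUnits ϖ (2 * k) ≤ higherUnits ϖ (2 * k + 1) ⊔ (unitsMap (R := R) (S := S)).range := by
  intro y hy
  cases k with
  | zero =>
    obtain ⟨x, hx⟩ := exists_unit_sub_algebraMap_dvd_one hπ' hϖ hπ hres y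
    exact mem_sup_of_sub_algebraMap_dvd (n := 2 * 0 + 1) (by simpa using hx)
  | succ m =>
    have e : 2 * (m + 1) = 2 * m + 2 := by ring
    rw [e] at hy
    obtain ⟨x, hx⟩ := exists_unit_sub_algebraMap_dvd_of_mem_higherUnits hπ' hπ hres hy
    have e3 : 2 * (m + 1) + 1 = 2 * m + 3 := by ring
    rw [e3]
    exact mem_sup_of_sub_algebraMap_dvd hx

/-- «No conjugate-orthogonal character of odd conductor exists at a ramified place», at the
level of the unit group: a homomorphism `χ : Sˣ →* M` trivial on `U_E^{2k+1}` and on the image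
of `Rˣ` is trivial on `U_E^{2k}` (residue degree one). -/
theorem eq_one_of_mem_higherUnits_two_mul {M : Type*} [Monoid M] (hπ' : Irreducible π)
    (hϖ : Irreducible ϖ) (hπ : algebraMap R S π = u * ϖ ^ 2)
    (hres : ∀ s : S, ∃ a : R, ϖ ∣ s - algebraMap R S a) (k : ℕ) (χ : Sˣ →* M)
    (h1 : ∀ y ∈ higherUnits ϖ (2 * k + 1), χ y = 1) (h2 : ∀ r : Rˣ, χ (unitsMap r) = 1) :
    ∀ y ∈ higherUnits ϖ (2 * k), χ y = 1 := by
  intro y hy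
  obtain ⟨a, ha, b, ⟨r, rfl⟩, rfl⟩ :=
    Subgroup.mem_sup.1 (higherUnits_two_mul_le_sup hπ' hϖ hπ hres k hy)
  rw [map_mul, h1 a ha, h2 r, one_mul]

/-- The two-sided statement at residue degree one: the subgroup generated by `U_E^{2k+1}` and
the base units contains `U_E^{2k}`, so `U_E^{2k} ⊔ image(Rˣ) = U_E^{2k+1} ⊔ image(Rˣ)`
(«the odd levels do not separate anything new»). -/
theorem higherUnits_two_mul_sup_eq (hπ' : Irreducible π) (hϖ : Irreducible ϖ)
    (hπ : algebraMap R S π = u * ϖ ^ 2)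
    (hres : ∀ s : S, ∃ a : R, ϖ ∣ s - algebraMap R S a) (k : ℕ) :
    higherUnits ϖ (2 * k) ⊔ (unitsMap (R := R) (S := S)).range =
      higherUnits ϖ (2 * k + 1) ⊔ (unitsMap (R := R) (S := S)).range := by
  refine le_antisymm (sup_le (higherUnits_two_mul_le_sup hπ' hϖ hπ hres k) le_sup_right) ?_
  exact sup_le_sup_right (higherUnits_succ_le ϖ _) _

end ResidueDegreeOne

end Summit.Ventures.HodgeRepro2.T5RamifiedUnitFiltration
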